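import Summits.ValiantsHypothesis.ValiantsHypothesis.Theorems.LacunarySymmetroidMatrixDescartesCensusGardingRows

/-!
# `MatrixDescartes` census — Gårding dictionary at `(3,4)`, part 3: row N3 (reverse Cauchy–Schwarz for the Lorentzian form `X ↦ tr(adj X · P)`)

HONEST FRAMING.  Companion of `…CensusGardingRows.lean` / `…CensusGardingDictionary.lean` (object-search cell `pub-symmetroid`; beside
the OPEN typed statement `DoorA34 = PosRootLawAt 3 4 18`, stmt-ValiantsHypothesis-19980).  Engine-2's LP34 row N3 (`LP34-CERT.md` §2):
for a positive definite letter `P` the quadratic form `q_P(X) = tr(adj X · P)` (`= 3 D(P,X,X)`, the `t¹`-coefficient of `det (tP + X)`)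
is LORENTZIAN on `Sym₃(ℝ)` (signature `(1,5)`), so a «timelike» `X` (`q_P(X) > 0`) satisfies the REVERSE Cauchy–Schwarz inequality
`q_P(X) q_P(Y) ≤ b_P(X,Y)²` with `b_P` the polarisation (`= 3 D(P,X,Y)`).  Kernel route: at `P = 1`, `q_1 = tr ∘ adj` is the sum of the
principal `2 × 2` minors, nonpositive on trace-free symmetric matrices (`trace_adjugate_nonpos_of_trace_zero`), whence reverse
Cauchy–Schwarz by one trace-free combination (`lorentz_reverse_cauchy_schwarz_one`); a general `P = M Mᵀ ≻ 0`
(`Census.exists_mul_transpose_of_posDef`) is reduced to `P = 1` by the congruence identity `tr(adj(M X Mᵀ) · M Mᵀ) = (det M)² tr(adj X)`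
(`trace_adjugate_congr`).  Rows for a DEFINITE letter only; nothing on the all-indefinite residue of `DoorA34`, on `ζ_sym(3,4)`, on
`MatrixDescartes` (stmt-ValiantsHypothesis-18050) or `VP ≠ VNP`.

[folklore] Gårding hyperbolicity of `det` on `Sym₃` / Lorentzian reverse Cauchy–Schwarz; elementary.
-/

-- `Summit.ValiantsHypothesis.ValiantsHypothesis.…` repeats a component by the D-0017 layout
-- (single-conjunct summit), which the `dupNamespace` linter flags; the name is mandated.
set_option linter.dupNamespace false

namespace Summit.ValiantsHypothesis.ValiantsHypothesis.Theorems.LacunarySymmetroidMatrixDescartes.Census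

open Polynomial Matrix Finset
open scoped BigOperators Polynomial Matrix

/-- `tr(adj Z)` for a `3 × 3` matrix: the sum of the three principal `2 × 2` minors. [folklore] -/
theorem trace_adjugate_fin_three (Z : Matrix (Fin 3) (Fin 3) ℝ) :
    Z.adjugate.trace = (Z 1 1 * Z 2 2 - Z 1 2 * Z 2 1) + (Z 0 0 * Z 2 2 - Z 0 2 * Z 2 0) + (Z 0 0 * Z 1 1 - Z 0 1 * Z 1 0) := by
  simp only [Matrix.adjugate_fin_three, Matrix.trace_fin_three, Matrix.of_apply, Matrix.cons_val', Matrix.cons_val_zero,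
    Matrix.cons_val_one, Matrix.head_cons, Matrix.cons_val_two, Matrix.tail_cons, Matrix.empty_val',
    Matrix.cons_val_fin_one, Matrix.head_fin_const]

/-- **The negative cone**: on trace-free SYMMETRIC `3 × 3` matrices `tr(adj Z) = −½‖Z‖² ≤ 0`. [folklore] -/
theorem trace_adjugate_nonpos_of_trace_zero {Z : Matrix (Fin 3) (Fin 3) ℝ} (hZ : Z.IsSymm) (h0 : Z.trace = 0) :
    Z.adjugate.trace ≤ 0 := by
  have h10 : Z 1 0 = Z 0 1 := by simpa using hZ.apply 0 1
  have h20 : Z 2 0 = Z 0 2 := by simpa using hZ.apply 0 2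
  have h21 : Z 2 1 = Z 1 2 := by simpa using hZ.apply 1 2
  rw [Matrix.trace_fin_three] at h0
  rw [trace_adjugate_fin_three, h10, h20, h21]
  nlinarith [sq_nonneg (Z 0 0), sq_nonneg (Z 1 1), sq_nonneg (Z 2 2), sq_nonneg (Z 0 1), sq_nonneg (Z 0 2), sq_nonneg (Z 1 2),
    sq_nonneg (Z 0 0 + Z 1 1 + Z 2 2)]

/-- The quadratic form `tr ∘ adj` along a pencil: `tr(adj (s•B − t•A)) = s² tr(adj B) − s t · [tr(adj(A+B)) − tr(adj A) − tr(adj B)] + t² tr(adj A)`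
(polarisation identity, `3 × 3`). [folklore] -/
theorem trace_adjugate_sub_smul (A B : Matrix (Fin 3) (Fin 3) ℝ) (s t : ℝ) :
    (s • B - t • A).adjugate.trace
      = s ^ 2 * B.adjugate.trace - s * t * ((A + B).adjugate.trace - A.adjugate.trace - B.adjugate.trace)
        + t ^ 2 * A.adjugate.trace := by
  simp only [trace_adjugate_fin_three, Matrix.sub_apply, Matrix.add_apply, Matrix.smul_apply, smul_eq_mul]
  ring

/-- **Reverse Cauchy–Schwarz at `P = 1`** (Lorentzian signature of `tr ∘ adj` on `Sym₃`): if `A, B` are symmetric `3 × 3` and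
`tr(adj A) > 0` (`A` timelike), then `tr(adj A) · tr(adj B) ≤ b(A,B)²` with `2 b(A,B) = tr(adj(A+B)) − tr(adj A) − tr(adj B)`.  Proof: the
trace-free combination `Z = (tr A) B − (tr B) A` has `tr(adj Z) ≤ 0`. [folklore] -/
theorem lorentz_reverse_cauchy_schwarz_one {A B : Matrix (Fin 3) (Fin 3) ℝ} (hA : A.IsSymm) (hB : B.IsSymm)
    (hq : 0 < A.adjugate.trace) :
    4 * (A.adjugate.trace * B.adjugate.trace) ≤ ((A + B).adjugate.trace - A.adjugate.trace - B.adjugate.trace) ^ 2 := by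
  -- the trace of `A` is nonzero: `tr(adj A) ≤ (tr A)² / 2`... we use `(tr A)² > 0` from `tr(adj A) > 0`
  have htr : 0 < A.trace ^ 2 := by
    have h10 : A 1 0 = A 0 1 := by simpa using hA.apply 0 1
    have h20 : A 2 0 = A 0 2 := by simpa using hA.apply 0 2
    have h21 : A 2 1 = A 1 2 := by simpa using hA.apply 1 2
    rw [Matrix.trace_fin_three]
    rw [trace_adjugate_fin_three, h10, h20, h21] at hq
    nlinarith [sq_nonneg (A 0 0 - A 1 1), sq_nonneg (A 0 0 - A 2 2), sq_nonneg (A 1 1 - A 2 2), sq_nonneg (A 0 1),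
      sq_nonneg (A 0 2), sq_nonneg (A 1 2)]
  -- the trace-free combination
  have hZs : (A.trace • B - B.trace • A).IsSymm := (hB.smul _).sub (hA.smul _)
  have hZ0 : (A.trace • B - B.trace • A).trace = 0 := by
    rw [Matrix.trace_sub, Matrix.trace_smul, Matrix.trace_smul, smul_eq_mul, smul_eq_mul]; ring
  have hZ := trace_adjugate_nonpos_of_trace_zero hZs hZ0
  rw [trace_adjugate_sub_smul] at hZ
  set qA := A.adjugate.trace
  set qB := B.adjugate.trace
  set b2 := (A + B).adjugate.trace - A.adjugate.trace - B.adjugate.trace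
  -- `(tr A)² qB − trA trB b2 + (tr B)² qA ≤ 0`, `qA > 0`, `(tr A)² > 0` ⇒ `4 qA qB ≤ b2²`
  have key : A.trace ^ 2 * (4 * (qA * qB)) ≤ A.trace ^ 2 * b2 ^ 2 := by
    nlinarith [sq_nonneg (A.trace * b2 - 2 * B.trace * qA), mul_nonneg hq.le (sq_nonneg B.trace), hZ, mul_pos htr hq]
  exact le_of_mul_le_mul_left key htr

/-- **Congruence identity**: `tr(adj(M X Mᵀ) · (M Mᵀ)) = (det M)² · tr(adj X)` (`3 × 3`; from `adj(UV) = adj V · adj U` and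
`U · adj U = det U • 1`). [folklore] -/
theorem trace_adjugate_congr (M X : Matrix (Fin 3) (Fin 3) ℝ) :
    ((M * X * Mᵀ).adjugate * (M * Mᵀ)).trace = M.det ^ 2 * X.adjugate.trace := by
  rw [Matrix.adjugate_mul_distrib, Matrix.adjugate_mul_distrib]
  -- adj Mᵀ * (adj X * adj M) * (M * Mᵀ) : regroup `adj M * M = det M • 1`
  have h1 : Mᵀ.adjugate * (X.adjugate * M.adjugate) * (M * Mᵀ) = M.det • (Mᵀ.adjugate * X.adjugate * Mᵀ) := by
    rw [Matrix.mul_assoc, Matrix.mul_assoc, ← Matrix.mul_assoc M.adjugate, Matrix.adjugate_mul, Matrix.smul_mul,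
      Matrix.one_mul, Matrix.mul_smul, Matrix.mul_smul, ← Matrix.mul_assoc]
  rw [h1, Matrix.trace_smul, Matrix.trace_mul_cycle, Matrix.mul_adjugate, det_transpose, Matrix.smul_mul, Matrix.one_mul,
    Matrix.trace_smul, smul_eq_mul, smul_eq_mul]
  ring

/-- **ROW N3 — reverse Cauchy–Schwarz for a positive definite letter** (`3 × 3`): for `P ≻ 0` and symmetric `X, Y` with
`q_P(X) := tr(adj X · P) > 0`, `4 q_P(X) q_P(Y) ≤ (q_P(X+Y) − q_P(X) − q_P(Y))²`, i.e. `D(P,X,X) D(P,Y,Y) ≤ D(P,X,Y)²` in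
mixed-discriminant currency (`q_P(X) = 3 D(P,X,X)`, `q_P(X+Y) − q_P(X) − q_P(Y) = 6 D(P,X,Y)`). [folklore] -/
theorem garding_row_N3 {P X Y : Matrix (Fin 3) (Fin 3) ℝ} (hP : P.PosDef) (hX : X.IsSymm) (hY : Y.IsSymm)
    (hq : 0 < (X.adjugate * P).trace) :
    4 * ((X.adjugate * P).trace * (Y.adjugate * P).trace)
      ≤ (((X + Y).adjugate * P).trace - (X.adjugate * P).trace - (Y.adjugate * P).trace) ^ 2 := by
  obtain ⟨M, hM, rfl⟩ := exists_mul_transpose_of_posDef hP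
  have hMu : IsUnit M.det := isUnit_iff_ne_zero.2 hM
  have hMT : IsUnit Mᵀ.det := by rw [det_transpose]; exact hMu
  -- pull back `X`, `Y` through the congruence
  have pull : ∀ Z : Matrix (Fin 3) (Fin 3) ℝ, Z.IsSymm →
      ∃ Z' : Matrix (Fin 3) (Fin 3) ℝ, Z'.IsSymm ∧ Z = M * Z' * Mᵀ := by
    intro Z hZ
    refine ⟨M⁻¹ * Z * Mᵀ⁻¹, ?_, ?_⟩
    · unfold Matrix.IsSymm
      rw [transpose_mul, transpose_mul, ← transpose_nonsing_inv, transpose_transpose, hZ.eq, transpose_nonsing_inv,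
        Matrix.mul_assoc]
    · calc Z = (M * M⁻¹) * Z * (Mᵀ⁻¹ * Mᵀ) := by
            rw [Matrix.mul_nonsing_inv M hMu, Matrix.nonsing_inv_mul Mᵀ hMT, Matrix.one_mul, Matrix.mul_one]
        _ = M * (M⁻¹ * Z * Mᵀ⁻¹) * Mᵀ := by simp only [Matrix.mul_assoc]
  obtain ⟨X', hX', rfl⟩ := pull X hX
  obtain ⟨Y', hY', rfl⟩ := pull Y hY
  have hsum : M * X' * Mᵀ + M * Y' * Mᵀ = M * (X' + Y') * Mᵀ := by
    rw [Matrix.mul_add, Matrix.add_mul]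
  rw [hsum, trace_adjugate_congr, trace_adjugate_congr, trace_adjugate_congr]
  rw [trace_adjugate_congr] at hq
  have hd : 0 < M.det ^ 2 := by positivity
  have hq' : 0 < X'.adjugate.trace := (pos_iff_pos_of_mul_pos hq).1 hd
  have base := lorentz_reverse_cauchy_schwarz_one hX' hY' hq'
  have e : (M.det ^ 2 * (X' + Y').adjugate.trace - M.det ^ 2 * X'.adjugate.trace - M.det ^ 2 * Y'.adjugate.trace) ^ 2
      = (M.det ^ 2) ^ 2 * ((X' + Y').adjugate.trace - X'.adjugate.trace - Y'.adjugate.trace) ^ 2 := by ring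
  rw [e]
  nlinarith [mul_le_mul_of_nonneg_left base (sq_nonneg (M.det ^ 2))]

end Summit.ValiantsHypothesis.ValiantsHypothesis.Theorems.LacunarySymmetroidMatrixDescartes.Census
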